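import Literature.NumberTheory.NumberFields.EquivariantUnramifiedHomClassGroup
import Literature.NumberTheory.NumberFields.EquivariantUnramifiedDescentDecomposition
import Literature.NumberTheory.NumberFields.EquivariantIwasawaLemmaClassGroupFrobenius
import HarnessLib

/-!
# Equivariant descent of an unramified character, V: the character dies if the equivariant part of
# the `S`-SPLIT class group does, the `S`-classes being killed by DECOMPOSITION GROUPS or by (c3*)
# (class-field-theoretic step of door L5 of the cell `bsd-potss`) — PROVED

Topic `NumberTheory/NumberFields` (namespace = path, grouping sub-namespace
`EquivariantUnramifiedDescent`).  THEOREM-ONLY file (no definition, no named fact, no `sorry`),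
written by the literature seat `bsd-potss-conjA-anchor` g18 (cell `bsd-potss`; serves the asides
stmt-BirchSwinnertonDyer-19386 / 19413; closes nothing).  `S`-version of file III
(`EquivariantUnramifiedHomClassGroup.forall_eq_zero_of_forall_equivariantHom_classGroup_eq_zero`):

* **`forall_eq_zero_of_forall_equivariantHom_classGroup_eq_zero_of_decomposition`** — `K` a number
  field, `p` odd, `L ⊆ K̄` finite Galois, `Λ′ = Gal(K̄/L)`, `Q ⊴ Γ_K` open inside `Λ′`, `V` `p`-torsion,
  `ψ : Γ_K → V` additive equivariant on `Λ′` with kernel `Q`, killing all inertia groups `I_𝔓 ∩ Λ′`;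
  `bad` a set of finite places of `K` each satisfying (T) «`ψ` kills `D_𝔮 ∩ Λ′` for all `𝔮 ∣ u`» or
  (C) «`V^{D_𝔮} = 0` for all `𝔮 ∣ u`».  IF every `Γ_K`-equivariant additive `Cl(𝓞_L) → V` killing the
  classes of the primes above `bad` is zero, THEN `ψ|_{Λ′} = 0`.  New inputs relative to file III: the
  Frobenius form of the equivariant Artin reciprocity (file
  `EquivariantIwasawaLemmaClassGroupFrobenius`), the lifting of decomposition groups through the closed
  subgroup `Gal(K̄/K̄^Q)` (file `EquivariantUnramifiedDescentDecomposition`), the decomposition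
  invariance of file VIII (`EquivariantFrobeniusInvariance`).

USE (door L5): with `ψ` the one-layer-up extension of a fine Selmer shadow at the layer `L = L₀K_N`,
(T) holds at the primes above `p` (total ramification) and at the primes not split in `L₀K_N/L₀`,
(C) at the places with `V^{D_v} = 0`; so a non-zero shadow contradicts
`Hom_Γ(Cl(L₀K_N)/⟨S-classes⟩, V) = 0` at ONE layer `N ≥ 1`.

## References

* D. A. Cox, *Primes of the form x² + ny²*, 2nd ed. (2013), §8.A Thm. 8.10, §5.C Cor. 5.24. [Cox2013]
* J. Neukirch, *Algebraic Number Theory* (1999), Ch. I §9; Ch. IV §6; Ch. VI (6.9), (7.1). [NeukirchANT1999]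
* J.-P. Serre, *Local Fields*, GTM 67 (1979), Ch. I §7 Prop. 22. [SerreLocalFields1979]
* S. V. Deo, A. Ray, R. Sujatha, Pure Appl. Math. Q. 19 (2023), §3 Thm. 3.8. [DeoRaySujatha2023]
* J. Coates, R. Sujatha, Math. Ann. 331 (2005), §3 Thm. 3.4 (proof). [CoatesSujatha2005]
-/

noncomputable section

open scoped Pointwise nonZeroDivisors
open NumberField Field IntermediateField Ideal IsDedekindDomain
open Literature.NumberTheory.GaloisRepresentations

namespace Literature.NumberTheory.NumberFields

namespace EquivariantUnramifiedDescent

section Helpers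

variable {k : Type} [Field k]

/-- Restriction `Γ_k → Gal(E/k)` is onto. [folklore] -/
private theorem absRestrictNormalHom_surjectiveD (E : IntermediateField k (AlgebraicClosure k))
    [Normal k E] : Function.Surjective (absRestrictNormalHom E) := fun g => by
  obtain ⟨σ, hσ⟩ := AlgEquiv.restrictNormalHom_surjective (AlgebraicClosure k) g
  exact ⟨(Field.absoluteGaloisGroup.toAlgEquiv k).symm σ, hσ⟩

/-- `((τ|_E) x : k̄) = τ • x`. [folklore] -/
private theorem coe_absRestrictNormalHom_applyD (E : IntermediateField k (AlgebraicClosure k))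
    [Normal k E] (τ : absoluteGaloisGroup k) (x : E) :
    ((absRestrictNormalHom E τ x : E) : AlgebraicClosure k) = τ • (x : AlgebraicClosure k) :=
  AlgEquiv.restrictNormalHom_apply E _ x

/-- `τ|_E = 1` iff `τ` fixes `E ⊆ k̄` pointwise. [folklore] -/
private theorem absRestrictNormalHom_eq_one_iffD (E : IntermediateField k (AlgebraicClosure k))
    [Normal k E] (τ : absoluteGaloisGroup k) :
    absRestrictNormalHom E τ = 1 ↔ ∀ x : E, τ • (x : AlgebraicClosure k) = x := by
  constructor
  · intro h x
    rw [← coe_absRestrictNormalHom_applyD E τ x, h, AlgEquiv.one_apply]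
  · intro h
    ext x
    rw [coe_absRestrictNormalHom_applyD E τ x, AlgEquiv.one_apply]
    exact h x

/-- A ring isomorphism maps non-zero ideals to non-zero ideals. [folklore] -/
private theorem map_mem_nonZeroDivisorsD {R S : Type*} [CommRing R] [IsDomain R] [CommRing S]
    [IsDomain S] (g : R ≃+* S) (J : (Ideal R)⁰) : (J : Ideal R).map (g : R →+* S) ∈ (Ideal S)⁰ := by
  rw [mem_nonZeroDivisors_iff_ne_zero]
  intro h
  exact nonZeroDivisors.ne_zero J.2 ((Ideal.map_eq_bot_iff_of_injective g.injective).mp h)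

/-- `ClassGroup.mulEquiv g` on the class of an integral ideal `J` is the class of `g(J)`. [folklore] -/
private theorem mulEquiv_mk0D {R S : Type*} [CommRing R] [IsDedekindDomain R] [CommRing S]
    [IsDedekindDomain S] (g : R ≃+* S) (J : (Ideal R)⁰) :
    ClassGroup.mulEquiv g (ClassGroup.mk0 J) =
      ClassGroup.mk0 ⟨_, map_mem_nonZeroDivisorsD g J⟩ := by
  have hmk : ∀ I : (FractionalIdeal R⁰ (FractionRing R))ˣ,
      ClassGroup.mulEquiv g (ClassGroup.mk (FractionRing R) I) =
        ClassGroup.mk (FractionRing S) (Units.mapEquiv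
          (FractionalIdeal.ringEquivOfRingEquiv (FractionRing R) (FractionRing S) g).toMulEquiv I) :=
    fun I => by
    rw [ClassGroup.mulEquiv, MulEquiv.trans_apply, MulEquiv.trans_apply, ClassGroup.equiv_mk,
      MulEquiv.symm_apply_eq, ClassGroup.equiv_mk, QuotientGroup.congr_mk']
    congr 1
    ext1
    simp [FractionalIdeal.canonicalEquiv_self]
  rw [← ClassGroup.mk_mk0 (FractionRing R) J, hmk, ← ClassGroup.mk_mk0 (FractionRing S)]
  congr 1
  ext1
  rw [Units.coe_mapEquiv, FractionalIdeal.coe_mk0, FractionalIdeal.coe_mk0]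
  exact AmbiguousClass.ringEquivOfRingEquiv_coeIdeal _ _ g J

/-- A prime of `ℤ̄_k` above a given maximal ideal of `𝓞 E`, for a number field `E ⊆ k̄`; it is maximal.
[folklore] -/
private theorem exists_isMaximal_comap_eqD (E : IntermediateField k (AlgebraicClosure k))
    (Q : Ideal (𝓞 E)) [hQ : Q.IsMaximal] :
    ∃ 𝔓 : Ideal (absIntegers (𝓞 k) k), 𝔓.IsMaximal ∧
      𝔓.comap (EllipticCurves.ringOfIntegersToIntegralClosure (k := k)
        (Ω := AlgebraicClosure k) E) = Q := by
  set φ : 𝓞 E →+* absIntegers (𝓞 k) k :=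
    EllipticCurves.ringOfIntegersToIntegralClosure (k := k) (Ω := AlgebraicClosure k) E with hφ
  letI : Algebra (𝓞 E) (absIntegers (𝓞 k) k) := φ.toAlgebra
  haveI : IsScalarTower (𝓞 k) (𝓞 E) (absIntegers (𝓞 k) k) :=
    IsScalarTower.of_algebraMap_eq fun x ↦ rfl
  haveI : Algebra.IsIntegral (𝓞 E) (absIntegers (𝓞 k) k) :=
    ⟨fun x ↦ (Algebra.IsIntegral.isIntegral (R := 𝓞 k) x).tower_top⟩
  obtain ⟨𝔓, -, h𝔓prime, h𝔓Q⟩ := Ideal.exists_ideal_over_prime_of_isIntegral Q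
    (⊥ : Ideal (absIntegers (𝓞 k) k))
    (fun x hx ↦ by
      rw [Ideal.mem_comap, Ideal.mem_bot] at hx
      have hx0 : x = 0 :=
        EllipticCurves.ringOfIntegersToIntegralClosure_injective E (hx.trans (map_zero _).symm)
      rw [hx0]
      exact Q.zero_mem)
  haveI := h𝔓prime
  refine ⟨𝔓, Ideal.isMaximal_of_isIntegral_of_isMaximal_comap (R := 𝓞 E) 𝔓 ?_, h𝔓Q⟩
  rw [h𝔓Q]
  exact hQ

end Helpers

section Main

variable {K : Type} [Field K] [NumberField K]

set_option maxHeartbeats 1600000 in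
set_option synthInstance.maxHeartbeats 200000 in
/-- **An everywhere-unramified equivariant character of `Gal(K̄/L)` vanishes if the `Γ_K`-equivariant
part of the `S`-SPLIT class group of `L` does — the `S`-classes being killed either by DECOMPOSITION
(`ψ` kills `D_𝔮 ∩ Λ′`) or by (c3*) (`V^{D_𝔮} = 0`).**  `K` a number field, `p` an odd prime, `L ⊆ K̄`
finite Galois over `K`, `Λ′ = {σ : σ|_L = 1}`, `Q ⊴ Γ_K` open with `Q ≤ Λ′`; `V` a `p`-torsion
`Γ_K`-module; `ψ : Γ_K → V` additive and `Γ_K`-equivariant on `Λ′`, `ker ψ ∩ Λ′ = Q`, killing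
`I_𝔓 ∩ Λ′` for every maximal `𝔓 ⊂ ℤ̄_K`; `bad` a set of finite places `u` of `K`, each of which satisfies
EITHER (T) `ψ` kills `D_𝔮 ∩ Λ′` for every prime `𝔮 ∣ u` of `ℤ̄_K`, OR (C) no non-zero vector of `V` is
fixed by `D_𝔮` (`𝔮 ∣ u`).  If every additive `Γ_K`-equivariant `μ : Cl(𝓞_L) → V` killing the classes of
the primes of `L` above the bad places is zero, then `ψ|_{Λ′} = 0`.  PROOF: as
`forall_eq_zero_of_forall_equivariantHom_classGroup_eq_zero` (descent of `ψ` to `ψ̄` on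
`G = Gal(K̄^Q/L)`, exponent `p` ⟹ odd ⟹ unramified at ∞; `χ = ψ̄ ∘ res` on `Gal(H_{K̄^Q}/L)`), closed by
the FROBENIUS form of the equivariant Artin reciprocity
(`EquivariantIwasawaLemma.inertiaTrivialHom_eq_zero_of_classGroupHom_eq_zero_of_frobAt`); its new input
«`χ` dies at the arithmetic Frobenius elements above the bad places» is produced: in case (T) by LIFTING
the Frobenius of `K̄^Q/L` into `D_𝔮 ∩ Λ′` (`EquivariantUnramifiedDescent.exists_mul_mem_stabilizer_of_isClosed`,
transitivity of `Gal(K̄/K̄^Q)` on the primes above `𝔮 ∩ K̄^Q`), where `ψ` vanishes; in case (C) by the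
decomposition invariance `EquivariantIwasawaLemma.smul_apply_eq_of_isArithFrobAt` (file VIII).
[cite: Cox2013, §8.A Thm. 8.10 and §5.C Cor. 5.24]
[cite: NeukirchANT1999, Ch. VI (6.9), (7.1), Ch. IV §6 and Ch. I §9 (9.1), (9.4)–(9.6)]
[cite: SerreLocalFields1979, Ch. I §7 Prop. 22]
[cite: DeoRaySujatha2023, §3 Thm. 3.8 (c2), (c3) and the definition of H′_L (arXiv:2202.09937 p. 9)] -/
theorem forall_eq_zero_of_forall_equivariantHom_classGroup_eq_zero_of_decomposition (p : ℕ) [Fact p.Prime]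
    (hp2 : p ≠ 2) (L : IntermediateField K (AlgebraicClosure K)) [FiniteDimensional K L]
    [IsGalois K L] [NumberField L] (Λ' Q : Subgroup (absoluteGaloisGroup K))
    (hΛ' : ∀ σ, σ ∈ Λ' ↔ absRestrictNormalHom L σ = 1) [hQn : Q.Normal]
    (hQ : IsOpen (Q : Set (absoluteGaloisGroup K))) (hQΛ' : Q ≤ Λ')
    {V : Type*} [AddCommGroup V] [DistribMulAction (absoluteGaloisGroup K) V]
    (hpV : ∀ v : V, p • v = 0) (ψ : absoluteGaloisGroup K → V)
    (hψmul : ∀ a ∈ Λ', ∀ b ∈ Λ', ψ (a * b) = ψ a + ψ b)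
    (hψequiv : ∀ (g : absoluteGaloisGroup K), ∀ σ ∈ Λ', ψ (g * σ * g⁻¹) = g • ψ σ)
    (hψker : ∀ σ ∈ Λ', ψ σ = 0 ↔ σ ∈ Q)
    (hψI : ∀ (𝔓 : Ideal (absIntegers (𝓞 K) K)), 𝔓.IsMaximal →
      ∀ σ ∈ 𝔓.inertia (absoluteGaloisGroup K), σ ∈ Λ' → ψ σ = 0)
    (bad : HeightOneSpectrum (𝓞 K) → Prop)
    (hbad : ∀ u : HeightOneSpectrum (𝓞 K), bad u →
      (∀ 𝔮 ∈ u.primesAbove, ∀ σ ∈ MulAction.stabilizer (absoluteGaloisGroup K) 𝔮,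
        σ ∈ Λ' → ψ σ = 0) ∨
      (∀ 𝔮 ∈ u.primesAbove, ∀ x : V,
        (∀ σ ∈ MulAction.stabilizer (absoluteGaloisGroup K) 𝔮, σ • x = x) → x = 0))
    (h0 : ∀ μ : Additive (ClassGroup (𝓞 L)) →+ V,
      (∀ (τ : absoluteGaloisGroup K) (c : ClassGroup (𝓞 L)),
        μ (Additive.ofMul (ClassGroup.mulEquiv
          (AmbiguousClass.intAut (absRestrictNormalHom L τ)) c)) = τ • μ (Additive.ofMul c)) →
      (∀ (v : HeightOneSpectrum (𝓞 L)) (u : HeightOneSpectrum (𝓞 K)), bad u →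
        v.asIdeal.under (𝓞 K) = u.asIdeal →
        μ (Additive.ofMul (ClassGroup.mk0 ⟨v.asIdeal, mem_nonZeroDivisors_of_ne_zero v.ne_bot⟩)) = 0) →
      μ = 0) :
    ∀ σ ∈ Λ', ψ σ = 0 := by
  classical
  have hp : p.Prime := Fact.out
  haveI : Algebra.IsAlgebraic K (AlgebraicClosure K) := AlgebraicClosure.isAlgebraic K
  haveI : IsGalois K (AlgebraicClosure K) := {}
  -- ### elementary consequences of additivity
  have hψ1 : ψ 1 = 0 := by
    have h := hψmul 1 Λ'.one_mem 1 Λ'.one_mem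
    rw [mul_one] at h
    exact left_eq_add.mp h
  have hψpow : ∀ u ∈ Λ', ∀ n : ℕ, ψ (u ^ n) = n • ψ u := by
    intro u hu n
    induction n with
    | zero => rw [pow_zero, hψ1, zero_smul]
    | succ n ih => rw [pow_succ, hψmul _ (Λ'.pow_mem hu n) _ hu, ih, succ_nsmul]
  -- ### the field `E' = K̄^Q ⊇ L`
  set E' : IntermediateField K (AlgebraicClosure K) := fixedField Q with hE'def
  have hE'Q : E'.fixingSubgroup = Q := fixingSubgroup_fixedField_of_isOpen Q hQ
  haveI : FiniteDimensional K E' := finiteDimensional_fixedField_of_isOpen Q hQ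
  haveI hE'gal : IsGalois K E' := by
    rw [← InfiniteGalois.normal_iff_isGalois, hE'Q]; exact hQn
  haveI : NumberField E' := NumberField.of_module_finite K E'
  have hΛ'fix : ∀ σ, σ ∈ Λ' ↔ ∀ x : L, σ • (x : AlgebraicClosure K) = x := fun σ =>
    (hΛ' σ).trans (absRestrictNormalHom_eq_one_iffD L σ)
  have hLE' : L ≤ E' := by
    rw [hE'def, IntermediateField.le_iff_le]
    intro σ hσ
    rw [IntermediateField.mem_fixingSubgroup_iff]
    intro x hx
    exact (hΛ'fix σ).1 (hQΛ' hσ) ⟨x, hx⟩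
  -- ### `L` as an intermediate field `Li` of `E'/K`
  set Li : IntermediateField K E' := IntermediateField.restrict hLE' with hLidef
  set eL : L ≃ₐ[K] Li := IntermediateField.restrict_algEquiv hLE' with heLdef
  have heL : ∀ y : L, (((eL y : Li) : E') : AlgebraicClosure K) = (y : AlgebraicClosure K) :=
    fun _ => rfl
  have hmemL : ∀ x : Li, ((x : E') : AlgebraicClosure K) ∈ L := fun x => (mem_restrict hLE' x.1).1 x.2
  haveI : IsGalois K Li := IsGalois.of_algEquiv eL
  haveI : FiniteDimensional K Li := IntermediateField.finiteDimensional_left Li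
  haveI : NumberField Li := NumberField.of_module_finite K Li
  haveI : IsGalois Li E' := IsGalois.tower_top_of_isGalois K Li E'
  haveI : FiniteDimensional Li E' := Module.Finite.of_restrictScalars_finite K Li E'
  -- ### the restriction `π : Γ_K → Gal(E'/K)`
  set π : absoluteGaloisGroup K →* (E' ≃ₐ[K] E') := absRestrictNormalHom E' with hπdef
  have hπ : Function.Surjective π := absRestrictNormalHom_surjectiveD E'
  have hval : ∀ (τ : absoluteGaloisGroup K) (x : E'),
      ((π τ x : E') : AlgebraicClosure K) = τ • (x : AlgebraicClosure K) :=
    coe_absRestrictNormalHom_applyD E'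
  have hQiff : ∀ σ : absoluteGaloisGroup K, σ ∈ Q ↔ ∀ x ∈ E', σ • x = x := fun σ => by
    refine (SetLike.ext_iff.mp hE'Q σ).symm.trans ?_
    exact IntermediateField.mem_fixingSubgroup_iff E' (absoluteGaloisGroup.toAlgEquiv K σ)
  have hπ1 : ∀ τ, π τ = 1 ↔ τ ∈ Q := by
    intro τ
    rw [hπdef, absRestrictNormalHom_eq_one_iffD E', hQiff]
    exact ⟨fun h x hx => h ⟨x, hx⟩, fun h x => h x x.2⟩
  -- `σ ∈ Λ' ↔ π σ fixes Li pointwise`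
  have hL1 : ∀ τ : absoluteGaloisGroup K,
      absRestrictNormalHom L τ = 1 ↔ ∀ x : Li, π τ (x : E') = x := by
    intro τ
    rw [absRestrictNormalHom_eq_one_iffD]
    constructor
    · intro h x
      apply Subtype.ext
      rw [hval]
      exact h ⟨_, hmemL x⟩
    · intro h y
      have := congrArg (fun z : E' => (z : AlgebraicClosure K)) (h (eL y))
      rwa [hval] at this
  have hΛ'1 : ∀ τ, τ ∈ Λ' ↔ ∀ x : Li, π τ (x : E') = x := fun τ => (hΛ' τ).trans (hL1 τ)
  -- ### the relative restriction `πL : Λ' → Gal(E'/Li)`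
  have hres_mem : ∀ u : Λ', π (u : absoluteGaloisGroup K) ∈ Li.fixingSubgroup := by
    intro u
    rw [IntermediateField.mem_fixingSubgroup_iff]
    intro x hx
    exact (hΛ'1 u).1 u.2 ⟨x, hx⟩
  let πL : Λ' →* (E' ≃ₐ[Li] E') :=
    (IntermediateField.fixingSubgroupEquiv Li).toMonoidHom.comp
      ((π.comp Λ'.subtype).codRestrict Li.fixingSubgroup hres_mem)
  have hπL : ∀ u : Λ', (πL u).restrictScalars K = π (u : absoluteGaloisGroup K) := fun u => rfl
  have hmemΛ'_of : ∀ (σ : absoluteGaloisGroup K) (τ : E' ≃ₐ[Li] E'),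
      π σ = τ.restrictScalars K → σ ∈ Λ' := by
    intro σ τ hσ
    rw [hΛ'1]
    intro x
    rw [hσ, AlgEquiv.restrictScalars_apply]
    exact τ.commutes x
  have hπL_surj : Function.Surjective πL := by
    intro τ
    obtain ⟨σ, hσ⟩ := hπ (τ.restrictScalars K)
    refine ⟨⟨σ, hmemΛ'_of σ τ hσ⟩, ?_⟩
    apply AlgEquiv.restrictScalars_injective K
    rw [hπL]
    exact hσ
  have hπL_one : ∀ u : Λ', πL u = 1 ↔ (u : absoluteGaloisGroup K) ∈ Q := by
    intro u
    rw [← hπ1, ← hπL]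
    constructor
    · intro h; rw [h]; rfl
    · intro h
      apply AlgEquiv.restrictScalars_injective K
      rw [h]; rfl
  have hπL_conj : ∀ (g : absoluteGaloisGroup K) (u : Λ'),
      (g * u * g⁻¹ : absoluteGaloisGroup K) ∈ Λ' := fun g u => by
    have hu := (hΛ' u).1 u.2
    rw [hΛ', map_mul, map_mul, map_inv, hu, mul_one, mul_inv_cancel]
  -- ### descent of `ψ` to `ψ̄ : Gal(E'/Li) → V`
  have hfactor : ∀ u₁ u₂ : Λ', πL u₁ = πL u₂ → ψ u₁ = ψ u₂ := by
    intro u₁ u₂ h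
    have h1 : πL (u₂⁻¹ * u₁) = 1 := by rw [map_mul, map_inv, h, inv_mul_cancel]
    have h2 : ψ ((u₂⁻¹ * u₁ : Λ') : absoluteGaloisGroup K) = 0 :=
      (hψker _ (u₂⁻¹ * u₁).2).2 ((hπL_one _).1 h1)
    have h3 : ψ u₁ = ψ ((u₂ : absoluteGaloisGroup K) * (u₂⁻¹ * u₁ : Λ')) := by
      rw [Subgroup.coe_mul, Subgroup.coe_inv, mul_inv_cancel_left]
    rw [h3, hψmul _ u₂.2 _ (u₂⁻¹ * u₁).2, h2, add_zero]
  let ψbar : (E' ≃ₐ[Li] E') → V := fun τ =>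
    ψ ((Function.surjInv hπL_surj τ : Λ') : absoluteGaloisGroup K)
  have hψbar : ∀ u : Λ', ψbar (πL u) = ψ u := fun u =>
    hfactor _ _ (Function.surjInv_eq hπL_surj (πL u))
  have hψbar_add : ∀ a b, ψbar (a * b) = ψbar a + ψbar b := by
    intro a b
    obtain ⟨x, rfl⟩ := hπL_surj a
    obtain ⟨y, rfl⟩ := hπL_surj b
    rw [← map_mul, hψbar, hψbar, hψbar, Subgroup.coe_mul, hψmul _ x.2 _ y.2]
  -- `Gal(E'/Li)` has exponent `p`, hence odd order: `E'/Li` unramified at infinity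
  have hexp : ∀ τ : E' ≃ₐ[Li] E', τ ^ p = 1 := by
    intro τ
    obtain ⟨u, rfl⟩ := hπL_surj τ
    rw [← map_pow, hπL_one, Subgroup.coe_pow]
    exact (hψker _ (Λ'.pow_mem u.2 p)).1 (by rw [hψpow _ u.2, hpV])
  haveI : IsUnramifiedAtInfinitePlaces Li E' := by
    apply IsUnramifiedAtInfinitePlaces_of_odd_card_aut
    have hG : IsPGroup p (E' ≃ₐ[Li] E') := fun τ => ⟨1, by rw [pow_one]; exact hexp τ⟩
    obtain ⟨m, hm⟩ := hG.exists_card_eq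
    rw [hm]
    exact (hp.odd_of_ne_two hp2).pow
  -- ### `ψ̄` kills the inertia groups of `Gal(E'/Li)`
  have hinert : ∀ (𝔔 : Ideal (𝓞 E')) [𝔔.IsMaximal],
      ∀ τ ∈ 𝔔.inertia (E' ≃ₐ[Li] E'), ψbar τ = 0 := by
    intro 𝔔 _ τ hτ
    obtain ⟨𝔓, h𝔓max, h𝔓Q⟩ := exists_isMaximal_comap_eqD E' 𝔔
    haveI := h𝔓max
    have hτK : τ.restrictScalars K ∈ 𝔔.inertia (E' ≃ₐ[K] E') := by
      rw [AddSubgroup.mem_inertia] at hτ ⊢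
      intro x
      rw [RingOfIntegers.restrictScalars_smul]
      exact hτ x
    rw [← h𝔓Q, inertia_comap_ringOfIntegers_eq_map_absRestrictNormalHom E' 𝔓] at hτK
    obtain ⟨σ, hσI, hσ⟩ := hτK
    have hσΛ : σ ∈ Λ' := hmemΛ'_of σ τ hσ
    have hπσ : πL ⟨σ, hσΛ⟩ = τ := by
      apply AlgEquiv.restrictScalars_injective K
      rw [hπL]
      exact hσ
    rw [← hπσ, hψbar]
    exact hψI 𝔓 h𝔓max σ hσI hσΛ
  -- ### the bad places of `Li` (those above a bad place of `K`)
  let badLi : HeightOneSpectrum (𝓞 Li) → Prop := fun w =>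
    ∃ u : HeightOneSpectrum (𝓞 K), bad u ∧ w.asIdeal.under (𝓞 K) = u.asIdeal
  have hbadLi : ∀ w, badLi w ↔ ∃ u : HeightOneSpectrum (𝓞 K), bad u ∧ w.asIdeal.under (𝓞 K) = u.asIdeal :=
    fun _ => Iff.rfl
  -- ### (c2) for `Li` with the `S`-split quotient, transported from `L` along `eL`
  have h0Li : ∀ μ : Additive (ClassGroup (𝓞 Li)) →+ V,
      (∀ (τ : absoluteGaloisGroup K) (c : ClassGroup (𝓞 Li)),
        μ (Additive.ofMul (ClassGroup.mulEquiv
          (AmbiguousClass.intAut ((π τ).restrictNormal Li)) c)) = τ • μ (Additive.ofMul c)) →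
      (∀ w : HeightOneSpectrum (𝓞 Li), badLi w →
        μ (Additive.ofMul (ClassGroup.mk0 ⟨w.asIdeal, mem_nonZeroDivisors_of_ne_zero w.ne_bot⟩)) = 0) →
      μ = 0 := by
    intro μ hμ hμS
    set gL : 𝓞 L ≃+* 𝓞 Li := RingOfIntegers.mapRingEquiv eL.toRingEquiv with hgLdef
    set eCl : ClassGroup (𝓞 L) ≃* ClassGroup (𝓞 Li) := ClassGroup.mulEquiv gL with heCldef
    set μ' : Additive (ClassGroup (𝓞 L)) →+ V :=
      AddMonoidHom.mk' (fun a => μ (Additive.ofMul (eCl (Additive.toMul a))))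
        (fun a b => by simp only [toMul_add, map_mul, ofMul_mul, map_add]) with hμ'def
    have hμ'apply : ∀ c : ClassGroup (𝓞 L),
        μ' (Additive.ofMul c) = μ (Additive.ofMul (eCl c)) := fun _ => rfl
    have hgcomp : ∀ τ : absoluteGaloisGroup K,
        (gL : 𝓞 L →+* 𝓞 Li).comp (AmbiguousClass.intAut (absRestrictNormalHom L τ) : 𝓞 L →+* 𝓞 L) =
          (AmbiguousClass.intAut ((π τ).restrictNormal Li) : 𝓞 Li →+* 𝓞 Li).comp
            (gL : 𝓞 L →+* 𝓞 Li) := by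
      intro τ
      refine RingHom.ext fun y => Subtype.ext <| Subtype.ext <| Subtype.ext ?_
      change (((eL (absRestrictNormalHom L τ (y : L)) : Li) : E') : AlgebraicClosure K) =
        ((algebraMap Li E' (((π τ).restrictNormal Li) (eL (y : L))) : E') : AlgebraicClosure K)
      rw [AlgEquiv.restrictNormal_commutes, heL, coe_absRestrictNormalHom_applyD L, hval]
      rfl
    have hcomp : ∀ (τ : absoluteGaloisGroup K) (c : ClassGroup (𝓞 L)),
        eCl (ClassGroup.mulEquiv (AmbiguousClass.intAut (absRestrictNormalHom L τ)) c) =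
          ClassGroup.mulEquiv (AmbiguousClass.intAut ((π τ).restrictNormal Li)) (eCl c) := by
      intro τ c
      obtain ⟨J, rfl⟩ := ClassGroup.mk0_surjective c
      rw [AmbiguousClass.mulEquiv_mk0, heCldef, mulEquiv_mk0D, mulEquiv_mk0D,
        AmbiguousClass.mulEquiv_mk0]
      congr 1
      apply Subtype.ext
      change ((J : Ideal (𝓞 L)).map _).map _ = ((J : Ideal (𝓞 L)).map _).map _
      rw [Ideal.map_map, Ideal.map_map, hgcomp]
    -- `gL` is compatible with `𝓞 K`
    have hgLalg : ∀ x : 𝓞 K, gL (algebraMap (𝓞 K) (𝓞 L) x) = algebraMap (𝓞 K) (𝓞 Li) x := by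
      intro x
      apply RingOfIntegers.coe_injective
      change eL (algebraMap K L (x : K)) = algebraMap K Li (x : K)
      exact eL.commutes (x : K)
    have hμ' : μ' = 0 := by
      refine h0 μ' (fun τ c => ?_) (fun v u hu hvu => ?_)
      · rw [hμ'apply, hμ'apply, hcomp]
        exact hμ τ (eCl c)
      · rw [hμ'apply, heCldef, mulEquiv_mk0D]
        haveI : (v.asIdeal.map (gL : 𝓞 L →+* 𝓞 Li)).IsPrime := Ideal.map_isPrime_of_equiv gL
        have hne : v.asIdeal.map (gL : 𝓞 L →+* 𝓞 Li) ≠ ⊥ := fun h =>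
          v.ne_bot ((Ideal.map_eq_bot_iff_of_injective gL.injective).mp h)
        set v' : HeightOneSpectrum (𝓞 Li) := ⟨v.asIdeal.map (gL : 𝓞 L →+* 𝓞 Li), inferInstance, hne⟩
          with hv'def
        have hv'u : v'.asIdeal.under (𝓞 K) = u.asIdeal := by
          rw [← hvu, Ideal.under_def, Ideal.under_def]
          ext x
          rw [Ideal.mem_comap, Ideal.mem_comap, hv'def, ← hgLalg]
          change (gL : 𝓞 L →+* 𝓞 Li) (algebraMap (𝓞 K) (𝓞 L) x) ∈
            Ideal.map (gL : 𝓞 L →+* 𝓞 Li) v.asIdeal ↔ _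
          rw [← Ideal.mem_comap, Ideal.comap_map_of_bijective (gL : 𝓞 L →+* 𝓞 Li)
            (show Function.Bijective (gL : 𝓞 L →+* 𝓞 Li) from gL.bijective)]
        exact hμS v' ⟨u, hu, hv'u⟩
    refine AddMonoidHom.ext fun a => ?_
    obtain ⟨c, rfl⟩ : ∃ c : ClassGroup (𝓞 Li), Additive.ofMul c = a := ⟨Additive.toMul a, rfl⟩
    have h := congrArg (fun ν : Additive (ClassGroup (𝓞 L)) →+ V => ν (Additive.ofMul (eCl.symm c))) hμ'
    simpa only [hμ'apply, MulEquiv.apply_symm_apply, AddMonoidHom.zero_apply] using h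
  -- ### the Hilbert class field `H = H_{E'}` and `χ = ψ̄ ∘ res`
  haveI : IsScalarTower K E' (hilbertClassField E') :=
    IsScalarTower.of_algebraMap_eq fun x => Subtype.ext (IsScalarTower.algebraMap_apply K E' _ x)
  haveI : IsScalarTower Li E' (hilbertClassField E') :=
    IsScalarTower.of_algebraMap_eq fun x => Subtype.ext (IsScalarTower.algebraMap_apply Li E' _ x)
  haveI : IsScalarTower K Li (hilbertClassField E') := IsScalarTower.of_algebraMap_eq fun x => by
    rw [IsScalarTower.algebraMap_apply Li E' (hilbertClassField E'),
      ← IsScalarTower.algebraMap_apply K Li E', ← IsScalarTower.algebraMap_apply K E' (hilbertClassField E')]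
  haveI : IsGalois Li (hilbertClassField E') := hilbertClassField.isGalois_of_isGalois E' (K := Li)
  set rE : (hilbertClassField E' ≃ₐ[Li] hilbertClassField E') →* (E' ≃ₐ[Li] E') :=
    AlgEquiv.restrictNormalHom E' with hrEdef
  have hrE_apply : ∀ a (x : E'), algebraMap E' (hilbertClassField E') (rE a x) =
      a (algebraMap E' (hilbertClassField E') x) := fun a x => AlgEquiv.restrictNormal_commutes a E' x
  have hrE_surj : Function.Surjective rE :=
    AlgEquiv.restrictNormalHom_surjective (hilbertClassField E')
  let χ : (hilbertClassField E' ≃ₐ[Li] hilbertClassField E') → V := fun a => ψbar (rE a)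
  have hχadd : ∀ a b, χ (a * b) = χ a + χ b := by
    intro a b
    change ψbar (rE (a * b)) = ψbar (rE a) + ψbar (rE b)
    rw [map_mul, hψbar_add]
  -- `χ` kills the inertia groups of `Gal(H/Li)` (they restrict into inertia groups of `Gal(E'/Li)`)
  have hχI : ∀ (Q' : Ideal (𝓞 (hilbertClassField E'))) [Q'.IsMaximal],
      ∀ s ∈ Q'.inertia (hilbertClassField E' ≃ₐ[Li] hilbertClassField E'), χ s = 0 := by
    intro Q' _ s hs
    haveI : (Q'.under (𝓞 E')).IsMaximal := Ideal.IsMaximal.under (𝓞 E') Q'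
    refine hinert (Q'.under (𝓞 E')) (rE s) ?_
    rw [AddSubgroup.mem_inertia] at hs ⊢
    intro y
    change algebraMap (𝓞 E') (𝓞 (hilbertClassField E')) (rE s • y - y) ∈ Q'
    have hsm : algebraMap (𝓞 E') (𝓞 (hilbertClassField E')) (rE s • y) =
        s • algebraMap (𝓞 E') (𝓞 (hilbertClassField E')) y := by
      apply RingOfIntegers.coe_injective
      change algebraMap E' (hilbertClassField E') ((rE s) (y : E')) =
        s (algebraMap E' (hilbertClassField E') (y : E'))
      exact hrE_apply s (y : E')
    rw [map_sub, hsm]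
    exact hs _
  -- `χ` is `Γ_K`-equivariant
  have hχequiv : ∀ (τ : absoluteGaloisGroup K)
      (g : hilbertClassField E' ≃ₐ[K] hilbertClassField E')
      (a a' : hilbertClassField E' ≃ₐ[Li] hilbertClassField E'),
      AlgEquiv.restrictNormalHom E' g = π τ → (∀ y, a' y = g (a (g.symm y))) → χ a' = τ • χ a := by
    intro τ g a a' hg ha'
    obtain ⟨u, hu⟩ := hπL_surj (rE a)
    -- `g` restricts to `π τ` on `E'`
    have hg_apply : ∀ x : E', g (algebraMap E' (hilbertClassField E') x) =
        algebraMap E' (hilbertClassField E') (π τ x) := by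
      intro x
      rw [← hg]
      exact (AlgEquiv.restrictNormal_commutes g E' x).symm
    have hg_symm : ∀ x : E', g.symm (algebraMap E' (hilbertClassField E') x) =
        algebraMap E' (hilbertClassField E') ((π τ)⁻¹ x) := by
      intro x
      apply g.injective
      rw [AlgEquiv.apply_symm_apply, hg_apply, ← AlgEquiv.mul_apply, mul_inv_cancel,
        AlgEquiv.one_apply]
    -- `a'` restricts to `πL (τ u τ⁻¹)` on `E'`
    have hconj : rE a' = πL ⟨τ * u * τ⁻¹, hπL_conj τ u⟩ := by
      apply AlgEquiv.ext
      intro x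
      have h1 : algebraMap E' (hilbertClassField E') (rE a' x) =
          algebraMap E' (hilbertClassField E') (π τ (rE a ((π τ)⁻¹ x))) := by
        rw [hrE_apply, ha', hg_symm, ← hrE_apply, hg_apply]
      have h2 : rE a' x = π τ (rE a ((π τ)⁻¹ x)) :=
        (algebraMap E' (hilbertClassField E')).injective h1
      rw [h2, ← hu]
      apply Subtype.ext
      change ((π τ ((πL u).restrictScalars K ((π τ)⁻¹ x)) : E') : AlgebraicClosure K) =
        (((πL ⟨τ * u * τ⁻¹, hπL_conj τ u⟩).restrictScalars K x : E') : AlgebraicClosure K)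
      rw [hπL, hπL, ← map_inv, hval, hval, hval, hval]
      change τ • ((u : absoluteGaloisGroup K) • (τ⁻¹ • (x : AlgebraicClosure K))) =
        (τ * u * τ⁻¹) • (x : AlgebraicClosure K)
      rw [mul_smul, mul_smul]
    change ψbar (rE a') = τ • ψbar (rE a)
    rw [hconj, hψbar, ← hu, hψbar]
    exact hψequiv τ u u.2
  -- ### `χ` dies at the Frobenius elements above the bad places
  haveI : IsGalois K (hilbertClassField E') := hilbertClassField.isGalois_of_isGalois E' (K := K)
  have hιalg : ∀ r : 𝓞 K,
      EllipticCurves.ringOfIntegersToIntegralClosure (k := K) (Ω := AlgebraicClosure K) E'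
        (algebraMap (𝓞 K) (𝓞 E') r) = algebraMap (𝓞 K) (absIntegers (𝓞 K) K) r := fun _ => rfl
  have hιsmul : ∀ (σ : absoluteGaloisGroup K) (y : 𝓞 E'),
      EllipticCurves.ringOfIntegersToIntegralClosure (k := K) (Ω := AlgebraicClosure K) E' (π σ • y) =
        σ • EllipticCurves.ringOfIntegersToIntegralClosure (k := K) (Ω := AlgebraicClosure K) E' y :=
    fun σ y => ringOfIntegersToIntegralClosure_absRestrictNormalHom_smul (L := E') σ y
  have hχFrob : ∀ (𝔔 : Ideal (𝓞 (hilbertClassField E'))) [𝔔.IsMaximal] (w : HeightOneSpectrum (𝓞 Li)),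
      badLi w → 𝔔.LiesOver w.asIdeal →
      ∀ g : hilbertClassField E' ≃ₐ[Li] hilbertClassField E', IsArithFrobAt (𝓞 Li) g 𝔔 → χ g = 0 := by
    intro 𝔔 _ w hw h𝔔w g hg
    obtain ⟨u, hu, hwu⟩ := (hbadLi w).1 hw
    haveI := h𝔔w
    -- the prime `𝔔' = 𝔔 ∩ 𝓞 E'`; `rE g` is an arithmetic Frobenius there
    haveI h𝔔'max : (𝔔.under (𝓞 E')).IsMaximal := Ideal.IsMaximal.under (𝓞 E') 𝔔
    have h𝔔'w : (𝔔.under (𝓞 E')).under (𝓞 Li) = w.asIdeal := by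
      rw [Ideal.under_under, ← h𝔔w.over]
    haveI : (𝔔.under (𝓞 E')).LiesOver w.asIdeal := ⟨h𝔔'w.symm⟩
    have hq : ∀ {S : Type} [CommRing S] [Algebra (𝓞 Li) S] (J : Ideal S) [J.LiesOver w.asIdeal],
        Nat.card (𝓞 Li ⧸ J.under (𝓞 Li)) = Nat.card (𝓞 Li ⧸ w.asIdeal) := by
      intro S _ _ J hJ
      rw [← hJ.over]
    have hgbar : IsArithFrobAt (𝓞 Li) (rE g) (𝔔.under (𝓞 E')) := by
      intro x
      rw [hq (𝔔.under (𝓞 E')), ← hq 𝔔, MulSemiringAction.toAlgHom_apply, Ideal.under_def,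
        Ideal.mem_comap, map_sub, map_pow]
      have h1 : algebraMap (𝓞 E') (𝓞 (hilbertClassField E')) (rE g • x) =
          g • algebraMap (𝓞 E') (𝓞 (hilbertClassField E')) x := by
        apply RingOfIntegers.coe_injective
        change algebraMap E' (hilbertClassField E') ((rE g) (x : E')) =
          g (algebraMap E' (hilbertClassField E') (x : E'))
        exact hrE_apply g (x : E')
      rw [h1]
      exact hg _
    -- a prime `𝔮` of `ℤ̄_K` above `𝔔'`, hence above `u`
    obtain ⟨𝔮, h𝔮max, h𝔮𝔔⟩ := exists_isMaximal_comap_eqD E' (𝔔.under (𝓞 E'))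
    haveI := h𝔮max
    have h𝔮under : 𝔮.under (𝓞 K) = (𝔔.under (𝓞 E')).under (𝓞 K) := by
      rw [← h𝔮𝔔]
      ext r
      rw [Ideal.under_def, Ideal.under_def, Ideal.mem_comap, Ideal.mem_comap, Ideal.mem_comap]
      exact (Iff.of_eq (congrArg (· ∈ 𝔮) (hιalg r))).symm
    have h𝔮u : 𝔮 ∈ u.primesAbove := by
      refine HeightOneSpectrum.mem_primesAbove_iff.mpr ⟨inferInstance, ⟨?_⟩⟩
      rw [h𝔮under, ← hwu, ← h𝔔'w, Ideal.under_under]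
    rcases hbad u hu with hT | hC
    · -- door L5: `ψ` kills the decomposition group `D_𝔮 ∩ Λ'`; lift `rE g` into it
      obtain ⟨σ₀, hσ₀⟩ := hπL_surj (rE g)
      have hπσ₀ : π (σ₀ : absoluteGaloisGroup K) = (rE g).restrictScalars K := by
        rw [← hπL σ₀, hσ₀]
      have hst : rE g • 𝔔.under (𝓞 E') = 𝔔.under (𝓞 E') :=
        MulAction.mem_stabilizer_iff.mp (IsArithFrobAt.mem_stabilizer hgbar)
      have hst' : π (σ₀ : absoluteGaloisGroup K) • 𝔔.under (𝓞 E') = 𝔔.under (𝓞 E') := by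
        rw [hπσ₀]
        ext x
        rw [Ideal.mem_pointwise_smul_iff_inv_smul_mem]
        have h : ((rE g).restrictScalars K)⁻¹ • x = (rE g)⁻¹ • x := Subtype.ext rfl
        rw [h, ← Ideal.mem_pointwise_smul_iff_inv_smul_mem, hst]
      -- `σ₀` stabilises `𝔮 ∩ (ℤ̄_K)^Q = 𝔔'`
      have hstab : ∀ b : absIntegers (𝓞 K) K, (∀ n ∈ Q, n • b = b) →
          (b ∈ 𝔮 ↔ (σ₀ : absoluteGaloisGroup K) • b ∈ 𝔮) := by
        intro b hb
        have hbE' : (b : AlgebraicClosure K) ∈ E' := by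
          rw [hE'def, IntermediateField.mem_fixedField_iff]
          intro f hf
          have h := congrArg Subtype.val (hb ((absoluteGaloisGroup.toAlgEquiv K).symm f) hf)
          rwa [integralClosure.coe_smul, absoluteGaloisGroup.toAlgEquiv_symm_apply] at h
        have hbint' : IsIntegral ℤ (b : AlgebraicClosure K) := isIntegral_trans (R := ℤ) (A := 𝓞 K) _ b.2
        have hbint : IsIntegral ℤ (⟨(b : AlgebraicClosure K), hbE'⟩ : E') :=
          (isIntegral_algebraMap_iff (algebraMap E' (AlgebraicClosure K)).injective).mp hbint'
        set b' : 𝓞 E' := ⟨⟨(b : AlgebraicClosure K), hbE'⟩, hbint⟩ with hb'def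
        have hιb' : EllipticCurves.ringOfIntegersToIntegralClosure (k := K) (Ω := AlgebraicClosure K) E' b'
            = b := Subtype.ext rfl
        have e1 : b ∈ 𝔮 ↔ b' ∈ 𝔔.under (𝓞 E') := by
          rw [← h𝔮𝔔]
          change b ∈ 𝔮 ↔
            EllipticCurves.ringOfIntegersToIntegralClosure (k := K) (Ω := AlgebraicClosure K) E' b' ∈ 𝔮
          rw [hιb']
          exact Iff.rfl
        have e2 : (σ₀ : absoluteGaloisGroup K) • b ∈ 𝔮 ↔
            π (σ₀ : absoluteGaloisGroup K) • b' ∈ 𝔔.under (𝓞 E') := by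
          rw [← h𝔮𝔔]
          change (σ₀ : absoluteGaloisGroup K) • b ∈ 𝔮 ↔
            EllipticCurves.ringOfIntegersToIntegralClosure (k := K) (Ω := AlgebraicClosure K) E'
              (π (σ₀ : absoluteGaloisGroup K) • b') ∈ 𝔮
          rw [hιsmul, hιb']
          exact Iff.rfl
        have e3 : π (σ₀ : absoluteGaloisGroup K) • b' ∈ 𝔔.under (𝓞 E') ↔ b' ∈ 𝔔.under (𝓞 E') := by
          conv_lhs => rw [← hst']
          exact Ideal.smul_mem_pointwise_smul_iff
        rw [e1, e2, e3]
      -- lift: `σ₀ n ∈ D_𝔮` for some `n ∈ Q`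
      letI : TopologicalSpace (absIntegers (𝓞 K) K) := ⊥
      haveI : DiscreteTopology (absIntegers (𝓞 K) K) := ⟨rfl⟩
      haveI := absIntegers.continuousSMul (𝓞 K) (K := K)
      obtain ⟨n, hnQ, hσn⟩ := EquivariantUnramifiedDescent.exists_mul_mem_stabilizer_of_isClosed Q
        (Q.isClosed_of_isOpen hQ) 𝔮 (σ₀ : absoluteGaloisGroup K) hstab
      have hσΛ : (σ₀ : absoluteGaloisGroup K) * n ∈ Λ' := Λ'.mul_mem σ₀.2 (hQΛ' hnQ)
      have hψσ : ψ ((σ₀ : absoluteGaloisGroup K) * n) = 0 := hT 𝔮 h𝔮u _ hσn hσΛ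
      have hπLσ : πL ⟨(σ₀ : absoluteGaloisGroup K) * n, hσΛ⟩ = rE g := by
        have e : (⟨(σ₀ : absoluteGaloisGroup K) * n, hσΛ⟩ : Λ') = σ₀ * ⟨n, hQΛ' hnQ⟩ := rfl
        rw [e, map_mul, (hπL_one ⟨n, hQΛ' hnQ⟩).mpr hnQ, mul_one, hσ₀]
      change ψbar (rE g) = 0
      rw [← hπLσ, hψbar]
      exact hψσ
    · -- (c3*) at `𝔮`: the value `χ g` is `D_𝔮`-invariant (file VIII), hence `0`
      refine hC 𝔮 h𝔮u (χ g) fun σ hσ => ?_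
      refine EquivariantIwasawaLemma.smul_apply_eq_of_isArithFrobAt (k := K) (B := Li) (F := E')
        (E := hilbertClassField E') π χ hχadd (fun Q' _ s hs => hχI Q' s hs) hχequiv 𝔔 g hg σ ?_
      have h := absRestrictNormalHom_mem_stabilizer_comap E' hσ
      rw [h𝔮𝔔] at h
      exact MulAction.mem_stabilizer_iff.mp h
  -- ### equivariant Artin reciprocity: `χ = 0`
  have key : ∀ a, χ a = 0 := fun a =>
    EquivariantIwasawaLemma.inertiaTrivialHom_eq_zero_of_classGroupHom_eq_zero_of_frobAt (k := K)
      (B := Li) (F := E') π hπ badLi h0Li χ hχadd (fun Q' _ s hs => hχI Q' s hs) hχequiv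
      (fun 𝔔 _ w hw h𝔔w g hg => hχFrob 𝔔 w hw h𝔔w g hg) a
  -- ### conclusion
  intro σ hσ
  obtain ⟨a, ha⟩ := hrE_surj (πL ⟨σ, hσ⟩)
  have h := key a
  change ψbar (rE a) = 0 at h
  rw [ha, hψbar] at h
  exact h

end Main

end EquivariantUnramifiedDescent

end Literature.NumberTheory.NumberFields

end
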